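import Literature.MathematicalPhysics.QuantumManyBody.PeriodicSmoothPairCutoff
import Literature.MathematicalPhysics.QuantumManyBody.PeriodicHardCoreTube
import Literature.MathematicalPhysics.QuantumManyBody.PeriodicFormCoreTrigPoly
import Literature.MathematicalPhysics.QuantumManyBody.BoseGasThermodynamicLimitRuelle
import Mathlib.Topology.Connected.PathConnected
import HarnessLib

/-!
# Lemma G: the torus form from the configuration-space form (bridge for the connectivity conjecture of skeleton v12)

Line `third-law-current-floor`, crux `BECConjugateDomination.HardCoreExtension` (stmt-AtomisticToContinuum-11786), lead c3.
The disprover's `LemmaGConnected` (Disproof §13) is typed on `(ℝ³)^N`: for `X, Y` in the free region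
`{X | ∀ i ≠ j, ∀ n ∈ ℤ³, b < ‖Xᵢ - Xⱼ - Ln‖}` of hard spheres of exclusion distance `b` on the torus of side `L = (N/ρ)^{1/3}`
(all lattice images), some relabelling `Y ∘ σ` is joined to `X` INSIDE the free region — in the dilute regime, eventually in `N`.
The simplicity argument of the line lives on the unit torus `(ℝ/ℤ)^{N×3}` with the nearest-image distance
`ρᵢⱼ = Torus.pairDist i j` and needs: the particle permutations act transitively on the connected components of
`U = {t | ∀ i ≠ j, b/L < ρᵢⱼ(t)}`. This file proves the torus form FROM the configuration-space form: lift `t, t'` by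
`fromUnitTorusN` (the lifts are free: every image distance is `≥ L ρᵢⱼ > b`, `norm_sub_sub_latticeVec_ge`), join the lifts
in the free region, and push the path down by the continuous covering map `toUnitTorusN L`, which maps the free region into
`U` (`pairDist_toUnitTorusN_eq_norm_recenter`), `fromUnitTorusN L t` to `t` and `Y ∘ σ` to the relabelling of `toUnitTorusN L Y`;
a path inside `U` keeps its end point in the connected component of its starting point.
-/

noncomputable section

namespace Summit.AtomisticToContinuum.BoseEinsteinCondensation.Cruxes.HardCoreExtension.ThirdLawCurrentFloorAlt

open Filter Set Topology
open Literature.MathematicalPhysics.QuantumManyBody.BoseGas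
open Literature.Analysis.FunctionSpaces

variable {N : ℕ}

/-- The covering map `toUnitTorusN L : (ℝ³)^N → (ℝ/ℤ)^{N×3}` is continuous. [folklore] -/
theorem continuous_toUnitTorusN (L : ℝ) : Continuous (toUnitTorusN (N := N) L) := by
  refine continuous_pi fun p => ?_
  have h : Continuous fun X : Config N => X p.1 p.2 / L :=
    (((EuclideanSpace.proj (𝕜 := ℝ) p.2).continuous).comp (continuous_apply p.1)).div_const L
  exact (continuous_quotient_mk'.comp h :)

/-- The scaled unit lattice vector is the side-`L` lattice vector: `L • latticeVec m = latticeVec L m`. [folklore] -/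
theorem smul_torusLatticeVec (L : ℝ) (m : Fin 3 → ℤ) : L • Torus.latticeVec m = latticeVec L m := by
  ext k
  rw [PiLp.smul_apply, Torus.latticeVec_apply, smul_eq_mul]
  rfl

/-- **The covering map sends free configurations into the free region of the torus**: if every image of the pair
`(i, j)` of `X` is at distance `> a` then `a/L < ρᵢⱼ(toUnitTorusN L X)` (`0 < L`). [folklore] -/
theorem div_lt_pairDist_toUnitTorusN {L a : ℝ} (hL : 0 < L) {X : Config N} {i j : Fin N}
    (hX : ∀ n : Fin 3 → ℤ, a < ‖X i - X j - latticeVec L n‖) : a / L < Torus.pairDist i j (toUnitTorusN L X) := by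
  rw [pairDist_toUnitTorusN_eq_norm_recenter]
  set m : Fin 3 → ℤ := fun k => round ((L⁻¹ • (X i - X j)) k) with hm
  have key : L⁻¹ • (X i - X j) - Torus.latticeVec m = L⁻¹ • (X i - X j - latticeVec L m) := by
    rw [← smul_torusLatticeVec L m, smul_sub L⁻¹ (X i - X j) (L • Torus.latticeVec m), smul_smul,
      inv_mul_cancel₀ hL.ne', one_smul]
  rw [key, norm_smul, Real.norm_eq_abs, abs_of_pos (inv_pos.2 hL), ← div_eq_inv_mul]
  exact div_lt_div_of_pos_right (hX m) hL

/-- **Lifts of free torus points are free configurations**: if `a/L < ρᵢⱼ(t)` for all `i ≠ j` (`0 < L`) then every image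
of every pair of `fromUnitTorusN L t` is at distance `> a`. [folklore] -/
theorem lt_norm_fromUnitTorusN_of_mem_free {L a : ℝ} (hL : 0 < L) {t : UnitAddTorus (Fin N × Fin 3)}
    (ht : ∀ i j : Fin N, i ≠ j → a / L < Torus.pairDist i j t) {i j : Fin N} (hij : i ≠ j) (n : Fin 3 → ℤ) :
    a < ‖fromUnitTorusN L t i - fromUnitTorusN L t j - latticeVec L n‖ := by
  have h1 : a < L * Torus.pairDist i j t := by
    have := ht i j hij
    rwa [div_lt_iff₀' hL] at this
  exact h1.trans_le (norm_sub_sub_latticeVec_ge hL.le t i j n)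

/-- **A path inside `F` keeps its end point in the connected component of its starting point.** [folklore] -/
theorem mem_connectedComponentIn_of_joinedIn {α : Type*} [TopologicalSpace α] {F : Set α} {x y : α}
    (h : JoinedIn F x y) : y ∈ connectedComponentIn F x := by
  obtain ⟨γ, hγ⟩ := h
  have hsub : range γ ⊆ connectedComponentIn F x :=
    (isConnected_range γ.continuous).isPreconnected.subset_connectedComponentIn ⟨0, γ.source⟩
      (range_subset_iff.2 hγ)
  exact hsub ⟨1, γ.target⟩

/-- **Lemma G, torus form from configuration-space form.** If, for every exclusion distance `b > 0`, in the dilute regime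
and eventually in `N`, any two free configurations of `(ℝ³)^N` (all lattice images of all pairs farther than `b`, side
`L_N = (N/ρ)^{1/3}`) are joined inside the free region up to a relabelling (the disprover's `LemmaGConnected`, Disproof
§13, with its free region written out), then for every `a > 0`, in the dilute regime and eventually in `N`, the particle
permutations act transitively on the connected components of the free region `{t | ∀ i ≠ j, a/L_N < ρᵢⱼ(t)}` of the unit
torus. [cite: BaryshnikovBubenikKahle2014, §6] [cite: Simanyi2004, (2.1.1)] -/
theorem lemmaG_torus_of_config
    (hG : ∀ b : ℝ, 0 < b → ∃ ρ₁ : ℝ, 0 < ρ₁ ∧ ∀ ρ : ℝ, 0 < ρ → ρ < ρ₁ → ∀ᶠ N : ℕ in atTop,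
      ∀ X ∈ {X : Config N | ∀ i j : Fin N, i ≠ j → ∀ n : Fin 3 → ℤ, b < ‖X i - X j - latticeVec (sideLength ρ N) n‖},
        ∀ Y ∈ {X : Config N | ∀ i j : Fin N, i ≠ j → ∀ n : Fin 3 → ℤ, b < ‖X i - X j - latticeVec (sideLength ρ N) n‖},
          ∃ σ : Equiv.Perm (Fin N),
            JoinedIn {X : Config N | ∀ i j : Fin N, i ≠ j → ∀ n : Fin 3 → ℤ, b < ‖X i - X j - latticeVec (sideLength ρ N) n‖}
              X (Y ∘ σ)) :
    ∀ a : ℝ, 0 < a → ∃ ρ₁ : ℝ, 0 < ρ₁ ∧ ∀ ρ : ℝ, 0 < ρ → ρ < ρ₁ → ∀ᶠ N : ℕ in atTop,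
      ∀ t ∈ {t : UnitAddTorus (Fin N × Fin 3) | ∀ i j : Fin N, i ≠ j → a / sideLength ρ N < Torus.pairDist i j t},
        ∀ t' ∈ {t : UnitAddTorus (Fin N × Fin 3) | ∀ i j : Fin N, i ≠ j → a / sideLength ρ N < Torus.pairDist i j t},
          ∃ σ : Equiv.Perm (Fin N), (fun p : Fin N × Fin 3 => t' (σ p.1, p.2)) ∈
            connectedComponentIn
              {t : UnitAddTorus (Fin N × Fin 3) | ∀ i j : Fin N, i ≠ j → a / sideLength ρ N < Torus.pairDist i j t} t := by
  intro a ha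
  obtain ⟨ρ₁, hρ₁, h⟩ := hG a ha
  refine ⟨ρ₁, hρ₁, fun ρ hρ hρ1 => ?_⟩
  filter_upwards [h ρ hρ hρ1, (tendsto_sideLength_atTop hρ).eventually_gt_atTop 0] with N hN hL
  intro t ht t' ht'
  set L : ℝ := sideLength ρ N with hLdef
  set F : Set (Config N) := {X : Config N | ∀ i j : Fin N, i ≠ j → ∀ n : Fin 3 → ℤ, a < ‖X i - X j - latticeVec L n‖}
    with hF
  set U : Set (UnitAddTorus (Fin N × Fin 3)) :=
    {t : UnitAddTorus (Fin N × Fin 3) | ∀ i j : Fin N, i ≠ j → a / L < Torus.pairDist i j t} with hU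
  -- the lifts are free configurations
  have hX : fromUnitTorusN L t ∈ F := fun i j hij n => lt_norm_fromUnitTorusN_of_mem_free hL ht hij n
  have hX' : fromUnitTorusN L t' ∈ F := fun i j hij n => lt_norm_fromUnitTorusN_of_mem_free hL ht' hij n
  obtain ⟨σ, hJ⟩ := hN _ hX _ hX'
  refine ⟨σ, ?_⟩
  -- push the joining path down to the torus
  have hπF : MapsTo (toUnitTorusN L) F U := fun Y hY i j hij => div_lt_pairDist_toUnitTorusN hL (hY i j hij)
  have hJ' : JoinedIn U (toUnitTorusN L (fromUnitTorusN L t)) (toUnitTorusN L (fromUnitTorusN L t' ∘ σ)) :=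
    (hJ.map_continuousOn (continuous_toUnitTorusN L).continuousOn).mono hπF.image_subset
  rw [toUnitTorusN_fromUnitTorusN hL.ne', toUnitTorusN_comp_perm, toUnitTorusN_fromUnitTorusN hL.ne'] at hJ'
  exact mem_connectedComponentIn_of_joinedIn hJ'

/-- **Closed form** (registered sub-goal `lemmaGBridge_c3` of the crux item; restatement of `lemmaG_torus_of_config`).
[cite: BaryshnikovBubenikKahle2014, §6] -/
theorem lemmaGBridge_c3 :
    (∀ b : ℝ, 0 < b → ∃ ρ₁ : ℝ, 0 < ρ₁ ∧ ∀ ρ : ℝ, 0 < ρ → ρ < ρ₁ → ∀ᶠ N : ℕ in Filter.atTop, ∀ X ∈ {X : Config N | ∀ i j : Fin N, i ≠ j → ∀ n : Fin 3 → ℤ, b < ‖X i - X j - latticeVec (sideLength ρ N) n‖}, ∀ Y ∈ {X : Config N | ∀ i j : Fin N, i ≠ j → ∀ n : Fin 3 → ℤ, b < ‖X i - X j - latticeVec (sideLength ρ N) n‖}, ∃ σ : Equiv.Perm (Fin N), JoinedIn {X : Config N | ∀ i j : Fin N, i ≠ j → ∀ n : Fin 3 → ℤ, b < ‖X i - X j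 - latticeVec (sideLength ρ N) n‖} X (Y ∘ σ)) → (∀ a : ℝ, 0 < a → ∃ ρ₁ : ℝ, 0 < ρ₁ ∧ ∀ ρ : ℝ, 0 < ρ → ρ < ρ₁ → ∀ᶠ N : ℕ in Filter.atTop, ∀ t ∈ {t : UnitAddTorus (Fin N × Fin 3) | ∀ i j : Fin N, i ≠ j → a / sideLength ρ N < Torus.pairDist i j t}, ∀ t' ∈ {t : UnitAddTorus (Fin N × Fin 3) | ∀ i j : Fin N, i ≠ j → a / sideLength ρ N < Torus.pairDist i j t}, ∃ σ : Equiv.Perm (Fin N), (fun p : Fin N × Fin 3 => t' (σ p.1, p.2)) ∈ connectedComponentIn {t : UnitAddTorus (Fin N × Fin 3) | ∀ i j : Fin N, i ≠ j → a / sideLength ρ N < Torus.pairDist i j t} t) :=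
  fun hG => lemmaG_torus_of_config hG

end Summit.AtomisticToContinuum.BoseEinsteinCondensation.Cruxes.HardCoreExtension.ThirdLawCurrentFloorAlt

end
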